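import Mathlib.Analysis.SpecialFunctions.Integrals.Basic
import Mathlib.MeasureTheory.Integral.IntervalIntegral.Basic
import HarnessLib

/-!
# The periodic Hilbert transform as an operator, and its action on every Fourier mode

Topic `Literature/Analysis/Fourier`. For a `2π`-periodic `f : ℝ → ℝ` the **periodic (conjugate-function) Hilbert
transform** in principal-value symmetric form is

  `Hf(x) = (2π)⁻¹ p.v.∫_{−π}^{π} f(x − t) cot(t/2) dt = (2π)⁻¹ ∫₀^π (f(x − t) − f(x + t)) cot(t/2) dt`

[cite: Grafakos2014, Ex. 4.1.4 (conjugate Poisson kernel on `𝕋¹` and its boundary operator) and Def. 5.1.1 folded onto `t > 0`];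
it is the operator with Fourier multiplier `−i·sgn k`, i.e. `H(cos kx) = sin kx`, `H(sin kx) = −cos kx` (`k ≥ 1`),
`H 1 = 0` — the convention `v_x = Hω` of the Okamoto–Sakajo–Wunsch / Constantin–Lax–Majda model on the circle
[cite: OkamotoSakajoWunsch2008, §1] and of `hilbertSymbol` in
`Literature/Analysis/FluidPDE/OkamotoSakajoWunsch2008/SeparableBlowup.lean`, which records that the library had no such
operator. We introduce ONE definition, `hilbertTransformCircle` (kernel written as `cos(t/2)/sin(t/2)`), and prove:

* the classical integral `∫₀^π sin(kt) cot(t/2) dt = π` for every integer `k ≥ 1`, by the telescoping identity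
  `(sin((k+1)t) − sin(kt)) cot(t/2) = cos((k+1)t) + cos(kt)` on `(0, π]` and `sin t cot(t/2) = 1 + cos t`;
* **`hilbertTransformCircle_sin`**: `H[sin(k·)](x) = −cos(kx)`, **`hilbertTransformCircle_cos`**: `H[cos(k·)](x) = sin(kx)`
  (`k ≥ 1`), `hilbertTransformCircle_const`: `H[c] = 0` — the multiplier `−i sgn k` mode by mode;
* homogeneity, additivity (under interval-integrability of the two symmetric integrands, supplied for the modes),
  translation covariance, parity.

All statements are classical (the multiplier identity is [cite: Grafakos2014, Ex. 4.1.4(c)] / Zygmund, Trigonometric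
Series, Ch. II §5 and Ch. VII (2.5)).
-/

namespace Literature.Analysis.Fourier

open _root_.MeasureTheory Set Filter intervalIntegral
open scoped Real Topology Interval

/-! ### The operator -/

/-- The **periodic Hilbert transform** (conjugate-function operator) in principal-value symmetric form,
`Hf(x) = (2π)⁻¹ ∫₀^π (f(x−t) − f(x+t)) cot(t/2) dt` (the kernel `cot(t/2)` is written `cos(t/2)/sin(t/2)`; Fourier multiplier
`−i sgn k`: `H cos k· = sin k·`, `H sin k· = −cos k·`, `H 1 = 0`). For integrands that are not interval-integrable the integral is `0`,
so every closed-form statement below carries (and proves) the integrability it needs.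
[cite: Grafakos2014, Ex. 4.1.4 (conjugate Poisson kernel / conjugate function on `𝕋¹`); OkamotoSakajoWunsch2008, §1 (`v_x = Hω`)] -/
noncomputable def hilbertTransformCircle (f : ℝ → ℝ) (x : ℝ) : ℝ :=
  (2 * π)⁻¹ * ∫ t in (0 : ℝ)..π, (f (x - t) - f (x + t)) * (Real.cos (t / 2) / Real.sin (t / 2))

/-! ### Structural rules -/

/-- Homogeneity: `H(c·f) = c·Hf`. [cite: Grafakos2014, Ex. 4.1.4 (linearity of the conjugate-function operator)] -/
theorem hilbertTransformCircle_const_mul (c : ℝ) (f : ℝ → ℝ) (x : ℝ) :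
    hilbertTransformCircle (fun y => c * f y) x = c * hilbertTransformCircle f x := by
  unfold hilbertTransformCircle
  have h : (fun t : ℝ => (c * f (x - t) - c * f (x + t)) * (Real.cos (t / 2) / Real.sin (t / 2))) =
      fun t : ℝ => c * ((f (x - t) - f (x + t)) * (Real.cos (t / 2) / Real.sin (t / 2))) := by
    funext t
    ring
  rw [h, intervalIntegral.integral_const_mul]
  ring

/-- `H(−f) = −Hf`. [cite: Grafakos2014, Ex. 4.1.4 (linearity of the conjugate-function operator)] -/
theorem hilbertTransformCircle_neg (f : ℝ → ℝ) (x : ℝ) :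
    hilbertTransformCircle (fun y => -f y) x = -hilbertTransformCircle f x := by
  have h := hilbertTransformCircle_const_mul (-1) f x
  simp only [neg_mul, one_mul] at h
  exact h

/-- Constants are annihilated: `H[c] = 0` (the `k = 0` mode; `sgn 0 = 0`). [cite: Grafakos2014, Ex. 4.1.4(c)] -/
theorem hilbertTransformCircle_const (c x : ℝ) : hilbertTransformCircle (fun _ => c) x = 0 := by
  unfold hilbertTransformCircle
  simp

/-- Additivity, under interval-integrability of the two symmetric integrands on `[0, π]`.
[cite: Grafakos2014, Ex. 4.1.4 (linearity of the conjugate-function operator)] -/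
theorem hilbertTransformCircle_add {f g : ℝ → ℝ} {x : ℝ}
    (hf : IntervalIntegrable (fun t => (f (x - t) - f (x + t)) * (Real.cos (t / 2) / Real.sin (t / 2))) volume 0 π)
    (hg : IntervalIntegrable (fun t => (g (x - t) - g (x + t)) * (Real.cos (t / 2) / Real.sin (t / 2))) volume 0 π) :
    hilbertTransformCircle (fun y => f y + g y) x = hilbertTransformCircle f x + hilbertTransformCircle g x := by
  unfold hilbertTransformCircle
  rw [← mul_add, ← intervalIntegral.integral_add hf hg]
  congr 1
  refine intervalIntegral.integral_congr fun t _ => ?_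
  simp only
  ring

/-- Translation covariance: `H[f(· − c)](x) = (Hf)(x − c)`. [cite: Grafakos2014, Ex. 4.1.4 (convolution operator)] -/
theorem hilbertTransformCircle_comp_sub_const (f : ℝ → ℝ) (c x : ℝ) :
    hilbertTransformCircle (fun y => f (y - c)) x = hilbertTransformCircle f (x - c) := by
  unfold hilbertTransformCircle
  simp only [sub_right_comm x _ c, add_sub_right_comm x _ c]

/-- Parity: the periodic Hilbert transform of an odd function is even. [cite: Grafakos2014, Ex. 4.1.4 (odd kernel)] -/
theorem hilbertTransformCircle_neg_arg_of_odd {f : ℝ → ℝ} (hf : ∀ y, f (-y) = -f y) (x : ℝ) :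
    hilbertTransformCircle f (-x) = hilbertTransformCircle f x := by
  unfold hilbertTransformCircle
  congr 1
  refine intervalIntegral.integral_congr fun t _ => ?_
  have e1 : -x - t = -(x + t) := by ring
  have e2 : -x + t = -(x - t) := by ring
  simp only [e1, e2, hf]
  ring

/-- Parity: the periodic Hilbert transform of an even function is odd. [cite: Grafakos2014, Ex. 4.1.4 (odd kernel)] -/
theorem hilbertTransformCircle_neg_arg_of_even {f : ℝ → ℝ} (hf : ∀ y, f (-y) = f y) (x : ℝ) :
    hilbertTransformCircle f (-x) = -hilbertTransformCircle f x := by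
  unfold hilbertTransformCircle
  rw [← mul_neg, ← intervalIntegral.integral_neg]
  congr 1
  refine intervalIntegral.integral_congr fun t _ => ?_
  have e1 : -x - t = -(x + t) := by ring
  have e2 : -x + t = -(x - t) := by ring
  simp only [e1, e2, hf]
  ring

/-! ### The classical integral `∫₀^π sin(kt) cot(t/2) dt = π` -/

/-- `sin t · cot(t/2) = 1 + cos t` for `sin(t/2) ≠ 0`. [folklore] -/
private theorem sin_mul_cot_half {t : ℝ} (ht : Real.sin (t / 2) ≠ 0) :
    Real.sin t * (Real.cos (t / 2) / Real.sin (t / 2)) = 1 + Real.cos t := by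
  have hs : Real.sin t = 2 * Real.sin (t / 2) * Real.cos (t / 2) := by
    rw [← Real.sin_two_mul]
    ring_nf
  have hc : Real.cos t = 2 * Real.cos (t / 2) ^ 2 - 1 := by
    rw [← Real.cos_two_mul]
    ring_nf
  rw [hs, hc]
  field_simp
  ring

/-- Telescoping identity `(sin((k+1)t) − sin(kt)) cot(t/2) = cos((k+1)t) + cos(kt)` for `sin(t/2) ≠ 0`. [folklore] -/
private theorem sin_succ_sub_sin_mul_cot_half (k : ℝ) {t : ℝ} (ht : Real.sin (t / 2) ≠ 0) :
    (Real.sin ((k + 1) * t) - Real.sin (k * t)) * (Real.cos (t / 2) / Real.sin (t / 2)) =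
      Real.cos ((k + 1) * t) + Real.cos (k * t) := by
  rw [Real.sin_sub_sin, Real.cos_add_cos]
  have e1 : ((k + 1) * t - k * t) / 2 = t / 2 := by ring
  have e2 : ((k + 1) * t + k * t) / 2 = (k + 1) * t - t / 2 := by ring
  have e3 : ((k + 1) * t - k * t) / 2 = t / 2 := by ring
  rw [e1, e2]
  field_simp

/-- On `(0, π]` the half-angle sine does not vanish. [folklore] -/
private theorem sin_half_ne_zero {t : ℝ} (ht : t ∈ Ioc (0 : ℝ) π) : Real.sin (t / 2) ≠ 0 := by
  have h1 : 0 < t / 2 := by linarith [ht.1]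
  have h2 : t / 2 < π := by linarith [ht.2, Real.pi_pos]
  exact (Real.sin_pos_of_pos_of_lt_pi h1 h2).ne'

/-- `∫₀^π cos(m t) dt = 0` for every integer `m ≥ 1`. [folklore] -/
private theorem integral_cos_nat_mul (m : ℕ) (hm : 1 ≤ m) :
    ∫ t in (0 : ℝ)..π, Real.cos ((m : ℝ) * t) = 0 := by
  have hm0 : (m : ℝ) ≠ 0 := by exact_mod_cast (Nat.one_le_iff_ne_zero.mp hm)
  rw [intervalIntegral.integral_comp_mul_left (fun t => Real.cos t) hm0, integral_cos]
  simp [Real.sin_nat_mul_pi]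

/-- **`∫₀^π sin(kt) cot(t/2) dt = π` for every integer `k ≥ 1`**, together with the interval-integrability of the integrand
(by induction: `k = 1` is `∫₀^π (1 + cos t) dt`; the step adds `∫₀^π (cos((k+1)t) + cos(kt)) dt = 0`). [folklore] -/
private theorem integral_sin_mul_cot_half (k : ℕ) (hk : 1 ≤ k) :
    IntervalIntegrable (fun t => Real.sin ((k : ℝ) * t) * (Real.cos (t / 2) / Real.sin (t / 2))) volume 0 π ∧
      ∫ t in (0 : ℝ)..π, Real.sin ((k : ℝ) * t) * (Real.cos (t / 2) / Real.sin (t / 2)) = π := by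
  induction k with
  | zero => exact absurd hk (by norm_num)
  | succ n ih =>
    rcases Nat.eq_zero_or_pos n with hn | hn
    · -- base case k = 1
      subst hn
      have heq : EqOn (fun t : ℝ => Real.sin (((0 + 1 : ℕ) : ℝ) * t) * (Real.cos (t / 2) / Real.sin (t / 2)))
          (fun t => 1 + Real.cos t) (Ι (0 : ℝ) π) := by
        intro t ht
        rw [uIoc_of_le Real.pi_pos.le] at ht
        have hc : (((0 + 1 : ℕ) : ℝ)) = 1 := by norm_num
        simp only [hc, one_mul]
        exact sin_mul_cot_half (sin_half_ne_zero ht)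
      have hint : IntervalIntegrable (fun t : ℝ => 1 + Real.cos t) volume 0 π :=
        (continuous_const.add Real.continuous_cos).intervalIntegrable _ _
      refine ⟨(intervalIntegrable_congr heq).2 hint, ?_⟩
      rw [intervalIntegral.integral_congr_ae (Eventually.of_forall heq),
        intervalIntegral.integral_add intervalIntegrable_const (Real.continuous_cos.intervalIntegrable 0 π)]
      simp [integral_cos]
    · -- step: k = n + 1 with n ≥ 1
      obtain ⟨ihint, ihval⟩ := ih hn
      have heq : EqOn (fun t : ℝ => Real.sin (((n + 1 : ℕ) : ℝ) * t) * (Real.cos (t / 2) / Real.sin (t / 2)))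
          (fun t => Real.sin ((n : ℝ) * t) * (Real.cos (t / 2) / Real.sin (t / 2))
            + (Real.cos (((n : ℝ) + 1) * t) + Real.cos ((n : ℝ) * t))) (Ι (0 : ℝ) π) := by
        intro t ht
        rw [uIoc_of_le Real.pi_pos.le] at ht
        have h := sin_succ_sub_sin_mul_cot_half (n : ℝ) (sin_half_ne_zero ht)
        simp only [Nat.cast_add, Nat.cast_one]
        linarith [h]
      have hc1 : Continuous fun t : ℝ => Real.cos (((n : ℝ) + 1) * t) := by fun_prop
      have hc2 : Continuous fun t : ℝ => Real.cos ((n : ℝ) * t) := by fun_prop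
      have hcos : IntervalIntegrable (fun t : ℝ => Real.cos (((n : ℝ) + 1) * t) + Real.cos ((n : ℝ) * t)) volume 0 π :=
        (hc1.add hc2).intervalIntegrable _ _
      refine ⟨(intervalIntegrable_congr heq).2 (ihint.add hcos), ?_⟩
      rw [intervalIntegral.integral_congr_ae (Eventually.of_forall heq), intervalIntegral.integral_add ihint hcos,
        ihval, intervalIntegral.integral_add (hc1.intervalIntegrable 0 π) (hc2.intervalIntegrable 0 π)]
      have h1 := integral_cos_nat_mul (n + 1) (by omega)
      have h2 := integral_cos_nat_mul n hn
      push_cast at h1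
      rw [h1, h2]
      ring

/-! ### The multiplier `−i sgn k`, mode by mode -/

/-- The symmetric integrand of `H[sin(k·)]` at `x` is `−2 cos(kx) · sin(kt) cot(t/2)`. [folklore] -/
private theorem sin_mode_symm_integrand (k x t : ℝ) :
    (Real.sin (k * (x - t)) - Real.sin (k * (x + t))) * (Real.cos (t / 2) / Real.sin (t / 2)) =
      -2 * Real.cos (k * x) * (Real.sin (k * t) * (Real.cos (t / 2) / Real.sin (t / 2))) := by
  rw [Real.sin_sub_sin]
  have e1 : (k * (x - t) - k * (x + t)) / 2 = -(k * t) := by ring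
  have e2 : (k * (x - t) + k * (x + t)) / 2 = k * x := by ring
  rw [e1, e2, Real.sin_neg]
  ring

/-- The symmetric integrand of `H[cos(k·)]` at `x` is `2 sin(kx) · sin(kt) cot(t/2)`. [folklore] -/
private theorem cos_mode_symm_integrand (k x t : ℝ) :
    (Real.cos (k * (x - t)) - Real.cos (k * (x + t))) * (Real.cos (t / 2) / Real.sin (t / 2)) =
      2 * Real.sin (k * x) * (Real.sin (k * t) * (Real.cos (t / 2) / Real.sin (t / 2))) := by
  rw [Real.cos_sub_cos]
  have e1 : (k * (x - t) + k * (x + t)) / 2 = k * x := by ring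
  have e2 : (k * (x - t) - k * (x + t)) / 2 = -(k * t) := by ring
  rw [e1, e2, Real.sin_neg]
  ring

/-- Interval-integrability of the symmetric integrand of `H[sin(k·)]` (`k ≥ 1`), for use with `hilbertTransformCircle_add`.
[cite: Grafakos2014, Ex. 4.1.4(c)] -/
theorem intervalIntegrable_hilbertCircle_sin (k : ℕ) (hk : 1 ≤ k) (x : ℝ) :
    IntervalIntegrable (fun t => (Real.sin ((k : ℝ) * (x - t)) - Real.sin ((k : ℝ) * (x + t)))
      * (Real.cos (t / 2) / Real.sin (t / 2))) volume 0 π := by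
  have h := (integral_sin_mul_cot_half k hk).1.const_mul (-2 * Real.cos ((k : ℝ) * x))
  exact h.congr_ae (Eventually.of_forall fun t => (sin_mode_symm_integrand (k : ℝ) x t).symm)

/-- Interval-integrability of the symmetric integrand of `H[cos(k·)]` (`k ≥ 1`). [cite: Grafakos2014, Ex. 4.1.4(c)] -/
theorem intervalIntegrable_hilbertCircle_cos (k : ℕ) (hk : 1 ≤ k) (x : ℝ) :
    IntervalIntegrable (fun t => (Real.cos ((k : ℝ) * (x - t)) - Real.cos ((k : ℝ) * (x + t)))
      * (Real.cos (t / 2) / Real.sin (t / 2))) volume 0 π := by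
  have h := (integral_sin_mul_cot_half k hk).1.const_mul (2 * Real.sin ((k : ℝ) * x))
  exact h.congr_ae (Eventually.of_forall fun t => (cos_mode_symm_integrand (k : ℝ) x t).symm)

/-- **`H[sin(k·)](x) = −cos(kx)` for every integer `k ≥ 1`** (multiplier `−i sgn k` on the odd modes).
[cite: Grafakos2014, Ex. 4.1.4(c); OkamotoSakajoWunsch2008, §1] -/
theorem hilbertTransformCircle_sin (k : ℕ) (hk : 1 ≤ k) (x : ℝ) :
    hilbertTransformCircle (fun y => Real.sin ((k : ℝ) * y)) x = -Real.cos ((k : ℝ) * x) := by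
  unfold hilbertTransformCircle
  simp_rw [sin_mode_symm_integrand (k : ℝ) x]
  rw [intervalIntegral.integral_const_mul, (integral_sin_mul_cot_half k hk).2]
  have hπ : (π : ℝ) ≠ 0 := Real.pi_ne_zero
  calc (2 * π)⁻¹ * (-2 * Real.cos ((k : ℝ) * x) * π)
      = -Real.cos ((k : ℝ) * x) * (π * π⁻¹) := by ring
    _ = -Real.cos ((k : ℝ) * x) := by rw [mul_inv_cancel₀ hπ, mul_one]

/-- **`H[cos(k·)](x) = sin(kx)` for every integer `k ≥ 1`** (multiplier `−i sgn k` on the even modes).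
[cite: Grafakos2014, Ex. 4.1.4(c); OkamotoSakajoWunsch2008, §1] -/
theorem hilbertTransformCircle_cos (k : ℕ) (hk : 1 ≤ k) (x : ℝ) :
    hilbertTransformCircle (fun y => Real.cos ((k : ℝ) * y)) x = Real.sin ((k : ℝ) * x) := by
  unfold hilbertTransformCircle
  simp_rw [cos_mode_symm_integrand (k : ℝ) x]
  rw [intervalIntegral.integral_const_mul, (integral_sin_mul_cot_half k hk).2]
  have hπ : (π : ℝ) ≠ 0 := Real.pi_ne_zero
  calc (2 * π)⁻¹ * (2 * Real.sin ((k : ℝ) * x) * π)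
      = Real.sin ((k : ℝ) * x) * (π * π⁻¹) := by ring
    _ = Real.sin ((k : ℝ) * x) := by rw [mul_inv_cancel₀ hπ, mul_one]

/-- The first modes explicitly: `H sin = −cos`, `H cos = sin`. [cite: Grafakos2014, Ex. 4.1.4(c)] -/
theorem hilbertTransformCircle_sin_one (x : ℝ) :
    hilbertTransformCircle Real.sin x = -Real.cos x ∧ hilbertTransformCircle Real.cos x = Real.sin x := by
  have h1 := hilbertTransformCircle_sin 1 le_rfl x
  have h2 := hilbertTransformCircle_cos 1 le_rfl x
  simp only [Nat.cast_one, one_mul] at h1 h2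
  exact ⟨h1, h2⟩

/-- A two-mode instance of the multiplier (how the rules combine on a trigonometric polynomial):
`H[α sin(k·) + β cos(k·)](x) = −α cos(kx) + β sin(kx)` for `k ≥ 1`. [cite: Grafakos2014, Ex. 4.1.4(c)] -/
theorem hilbertTransformCircle_mode (k : ℕ) (hk : 1 ≤ k) (α β x : ℝ) :
    hilbertTransformCircle (fun y => α * Real.sin ((k : ℝ) * y) + β * Real.cos ((k : ℝ) * y)) x =
      -α * Real.cos ((k : ℝ) * x) + β * Real.sin ((k : ℝ) * x) := by
  have hf := (intervalIntegrable_hilbertCircle_sin k hk x).const_mul α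
  have hg := (intervalIntegrable_hilbertCircle_cos k hk x).const_mul β
  have hf' : IntervalIntegrable (fun t => (α * Real.sin ((k : ℝ) * (x - t)) - α * Real.sin ((k : ℝ) * (x + t)))
      * (Real.cos (t / 2) / Real.sin (t / 2))) volume 0 π :=
    hf.congr_ae (Eventually.of_forall fun t => by simp only; ring)
  have hg' : IntervalIntegrable (fun t => (β * Real.cos ((k : ℝ) * (x - t)) - β * Real.cos ((k : ℝ) * (x + t)))
      * (Real.cos (t / 2) / Real.sin (t / 2))) volume 0 π :=
    hg.congr_ae (Eventually.of_forall fun t => by simp only; ring)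
  have hadd : hilbertTransformCircle (fun y => α * Real.sin ((k : ℝ) * y) + β * Real.cos ((k : ℝ) * y)) x =
      hilbertTransformCircle (fun y => α * Real.sin ((k : ℝ) * y)) x
        + hilbertTransformCircle (fun y => β * Real.cos ((k : ℝ) * y)) x :=
    hilbertTransformCircle_add hf' hg'
  rw [hadd, hilbertTransformCircle_const_mul, hilbertTransformCircle_const_mul, hilbertTransformCircle_sin k hk x,
    hilbertTransformCircle_cos k hk x]
  ring

end Literature.Analysis.Fourier
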